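import Literature.NumberTheory.Automorphic.ResGL2BorelStabilizerFinite
import Literature.Algebra.Homology.FreeAbelianCohomologyEigenbasis
import Literature.Algebra.Homology.ScalarFilteredFiniteIndex
import Literature.Algebra.Homology.ScalarFilteredPolyCyclicChain
import Literature.Algebra.Homology.PairMapFiltrationCharacters
import HarnessLib

/-!
# Torus weights on the cohomology of the Borel stabilisers of `Res_{K/ℚ} GL₂` with character coefficients

Topic `NumberTheory/Automorphic`; namespace `Literature.NumberTheory.Automorphic.ResGLnCohomology`.
Definitions with bodies and theorems (no named fact).

Let `Γ_x ≤ B(K)⁺` be the stabiliser of the boundary point `x = diag(t) c K_f(𝔫)`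
(`borelPosStabilizer`, `c ∈ GL₂(𝒪̂_K)`, `𝔫 ≠ 0`), `η : B(K)⁺ →* Eˣ` a character trivial on the
unipotent elements whose value on the torus elements `s_x = diag(1, x)` is a monomial
`∏_τ τ(x)^{n_τ}` in the embeddings, and `(s_x)_{x ∈ X}` integral torus elements normalising `Γ_x`.
Then (`scalarFiltered_conj_borelPosStabilizer_char`) **for every `n` the pair operators
`Hⁿ(γ ↦ s_x⁻¹ γ s_x, η(s_x))` on `Hⁿ(Γ_x, E_η)` admit a filtration with graded pieces on which they
act through algebraic characters `x ↦ ∏_τ τ(x)^{p_τ}`** (`algCharSet`).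

Proof (the dévissage of [Harder1987, §2, (2.3)–(2.8)] for the character pieces of the coefficients):
on the unipotent lattice `Λ_t ≅ ℤ^{[K:ℚ]}` the exterior-algebra eigenbasis of `H•(ℤ^d, E)` for the
additive characters `τ ∘ (upper right entry)` (`FreeAbelianCohomologyEigenbasis`, eigen-coordinates
`τ(x)`); ascent along the totally positive congruence units (`ScalarFilteredPolyCyclicChain`, the
units commute with the torus); ascent to `Γ_x` of finite index (`ScalarFilteredFiniteIndex`).

## References

* G. Harder, *Eisenstein cohomology of arithmetic groups. The case GL₂*, Invent. Math. 89 (1987), §2.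
  [Harder1987]
* K. S. Brown, *Cohomology of Groups*, GTM 87 (1982), III §8–§10, V §6. [Brown1982CohomologyGroups]
-/

noncomputable section

open scoped NumberField
open NumberField IsDedekindDomain CategoryTheory groupCohomology Literature.LinearAlgebra Literature.Algebra.Homology
  Literature.NumberTheory.Automorphic.BigHeckeGLn Literature.NumberTheory.Automorphic.ParallelWeight
  Literature.NumberTheory.Automorphic.BorelLattice Literature.NumberTheory.Automorphic.UnitCongruence

namespace Literature.NumberTheory.Automorphic

namespace ResGLnCohomology

variable {K : Type} [Field K]

/-! ### Conjugation by the torus elements `diag(1, x)` -/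

/-- `diag(1,x)⁻¹ (a β; 0 δ) diag(1,x) = (a, βx; 0, δ)`. [folklore] -/
theorem diag_inv_mul_bMat_mul_diag (x a : Kˣ) (β : K) (δ : Kˣ) :
    (bMat 1 0 x)⁻¹ * bMat a β δ * bMat 1 0 x = bMat a (β * x) δ := by
  rw [bMat_inv, bMat_mul, bMat_mul]
  congr 1
  · rw [inv_one, one_mul, mul_one]
  · simp
  · rw [mul_comm x⁻¹ δ, mul_assoc, inv_mul_cancel, mul_one]

/-- Conjugation by `diag(1, x)` preserves `B(Λ, A, D)` when `Λ x ⊆ Λ`. [folklore] -/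
theorem conj_diag_mem_borelOf {Λ : Submodule ℤ K} {A D : Subgroup Kˣ} {hA : ∀ a ∈ A, ∀ y ∈ Λ, (a : K) * y ∈ Λ}
    {hD : ∀ d ∈ D, ∀ y ∈ Λ, y * (d : K) ∈ Λ} (x : Kˣ) (hx : ∀ β ∈ Λ, β * x ∈ Λ) {g : GL (Fin 2) K}
    (hg : g ∈ borelOf Λ A D hA hD) : (bMat 1 0 x)⁻¹ * g * bMat 1 0 x ∈ borelOf Λ A D hA hD := by
  obtain ⟨a, ha, d, hd, β, hβ, rfl⟩ := hg
  rw [diag_inv_mul_bMat_mul_diag]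
  exact bMat_mem_borelOf_iff.2 ⟨ha, hd, hx β hβ⟩

/-- The upper right entry of the conjugate. [folklore] -/
theorem conj_diag_apply_zero_one (x : Kˣ) (g : GL (Fin 2) K) (h10 : (g : Matrix (Fin 2) (Fin 2) K) 1 0 = 0) :
    (((bMat 1 0 x)⁻¹ * g * bMat 1 0 x : GL (Fin 2) K) : Matrix (Fin 2) (Fin 2) K) 0 1 =
      (g : Matrix (Fin 2) (Fin 2) K) 0 1 * x := by
  obtain ⟨a, β, d, rfl⟩ := exists_eq_bMat h10
  rw [diag_inv_mul_bMat_mul_diag, bMat_apply_zero_one, bMat_apply_zero_one]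

/-! ### Chains of subgroups pulled back along an injective homomorphism -/

section Comap

variable {G G' : Type} [Group G] [Group G'] (f : G' →* G)

/-- Normality of consecutive terms is preserved by `comap`. [folklore] -/
theorem normal_subgroupOf_comap (H L : Subgroup G) [hN : (H.subgroupOf L).Normal] :
    ((H.comap f).subgroupOf (L.comap f)).Normal := by
  refine ⟨fun n hn g => ?_⟩
  rw [Subgroup.mem_subgroupOf, Subgroup.mem_comap] at hn ⊢
  have h := hN.conj_mem ⟨f (n : G'), n.2⟩ (Subgroup.mem_subgroupOf.2 hn) ⟨f (g : G'), g.2⟩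
  rw [Subgroup.mem_subgroupOf] at h
  simpa only [Subgroup.coe_mul, Subgroup.coe_inv, map_mul, map_inv] using h

/-- Infinite cyclic quotients are preserved by `comap` along a map whose range contains the bigger
group. [folklore] -/
theorem cyclic_comap {H L : Subgroup G} (hL : L ≤ f.range) {t : G} (ht : t ∈ L)
    (hgen : ∀ g ∈ L, ∃ h ∈ H, ∃ n : ℤ, g = h * t ^ n) (hfree : ∀ n : ℤ, t ^ n ∈ H → n = 0) :
    ∃ t' ∈ L.comap f, f t' = t ∧ (∀ g ∈ L.comap f, ∃ h ∈ H.comap f, ∃ n : ℤ, g = h * t' ^ n) ∧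
      (∀ n : ℤ, t' ^ n ∈ H.comap f → n = 0) := by
  obtain ⟨t', rfl⟩ := hL ht
  refine ⟨t', ht, rfl, fun g hg => ?_, fun n hn => hfree n (by simpa using hn)⟩
  obtain ⟨h, hh, n, hg'⟩ := hgen (f g) hg
  refine ⟨g * (t' ^ n)⁻¹, ?_, n, by rw [inv_mul_cancel_right]⟩
  rw [Subgroup.mem_comap, map_mul, map_inv, map_zpow, hg', mul_inv_cancel_right]
  exact hh

end Comap

/-! ### Algebraic characters -/

section AlgChar

variable [NumberField K] {E : Type} [Field E] [CharZero E] {X : Type} (xv : X → K)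

/-- The algebraic characters `x ↦ ∏_τ τ(x)^{p_τ}` (`p_τ ∈ ℤ`) on `X → K`. [cite: Harder1987, §2, (2.7)] -/
def algCharSet : Set (X → E) :=
  {χ | ∃ p : (K →+* E) → ℤ, ∀ x, χ x = ∏ τ : K →+* E, τ (xv x) ^ p τ}

/-- Products of algebraic characters are algebraic. [folklore] -/
theorem mul_mem_algCharSet {χ₁ χ₂ : X → E} (h₁ : χ₁ ∈ algCharSet (E := E) xv) (h₂ : χ₂ ∈ algCharSet (E := E) xv)
    (hx : ∀ x, xv x ≠ 0) : (fun x => χ₁ x * χ₂ x) ∈ algCharSet (E := E) xv := by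
  obtain ⟨p₁, hp₁⟩ := h₁
  obtain ⟨p₂, hp₂⟩ := h₂
  refine ⟨p₁ + p₂, fun x => ?_⟩
  change χ₁ x * χ₂ x = _
  rw [hp₁, hp₂, ← Finset.prod_mul_distrib]
  refine Finset.prod_congr rfl fun τ _ => ?_
  rw [Pi.add_apply, zpow_add₀ ((map_ne_zero τ).2 (hx x))]

/-- A single embedding is an algebraic character. [folklore] -/
theorem embedding_mem_algCharSet [DecidableEq (K →+* E)] (τ₀ : K →+* E) :
    (fun x => τ₀ (xv x)) ∈ algCharSet (E := E) xv := by
  refine ⟨fun τ => if τ = τ₀ then 1 else 0, fun x => ?_⟩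
  change τ₀ (xv x) = ∏ τ : K →+* E, τ (xv x) ^ (if τ = τ₀ then (1 : ℤ) else 0)
  rw [Finset.prod_eq_single τ₀ (fun τ _ hτ => by rw [if_neg hτ, zpow_zero]) (fun h => absurd (Finset.mem_univ _) h),
    if_pos rfl, zpow_one]

/-- Finite products of embeddings times an algebraic character are algebraic. [folklore] -/
theorem mul_prod_embedding_mem_algCharSet {a : X → E} (ha : a ∈ algCharSet (E := E) xv) (hx : ∀ x, xv x ≠ 0)
    {n : ℕ} (τs : Fin n → (K →+* E)) : (fun x => a x * ∏ i, τs i (xv x)) ∈ algCharSet (E := E) xv := by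
  classical
  induction n with
  | zero =>
    simpa using ha
  | succ n ih =>
    have h := mul_mem_algCharSet xv (ih (fun i => τs (Fin.castSucc i))) (embedding_mem_algCharSet xv (τs (Fin.last n))) hx
    convert h using 2 with x
    rw [Fin.prod_univ_castSucc, mul_assoc]

end AlgChar

/-! ### The unipotent lattice subgroups of `B(K)⁺` -/

section Lattice

variable (K) in
/-- The unipotent element `n(β) = (1 β; 0 1)` of `B(K)⁺`. [folklore] -/
def unipPos (β : K) : borelPos K :=
  bMatPos 1 1 β (fun τ => by simp)

/-- `n(β)` in `GL₂(K)`. [folklore] -/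
@[simp]
theorem borelPosToGL_unipPos (β : K) : borelPosToGL K (unipPos K β) = bMat 1 β 1 :=
  borelPosToGL_bMatPos 1 1 β _

/-- `n(β + β') = n(β) n(β')`. [folklore] -/
theorem unipPos_add (β β' : K) : unipPos K (β + β') = unipPos K β * unipPos K β' := by
  apply borelPosToGL_injective
  rw [map_mul, borelPosToGL_unipPos, borelPosToGL_unipPos, borelPosToGL_unipPos, bMat_mul, mul_one, Units.val_one,
    one_mul, mul_one, add_comm]

/-- `n(0) = 1`. [folklore] -/
theorem unipPos_zero : unipPos K (0 : K) = 1 := by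
  apply borelPosToGL_injective
  rw [map_one, borelPosToGL_unipPos, bMat_one]

/-- `β ↦ n(β)` is injective. [folklore] -/
theorem unipPos_injective : Function.Injective (unipPos K) := fun β β' h => by
  have h' := congrArg (borelPosToGL K) h
  rw [borelPosToGL_unipPos, borelPosToGL_unipPos] at h'
  exact (bMat_injective h').2.1

variable (K) in
/-- `β ↦ n(β)` as a homomorphism `K →* B(K)⁺` (from `Multiplicative K`). [folklore] -/
def unipPosHom : Multiplicative K →* borelPos K where
  toFun β := unipPos K β.toAdd
  map_one' := unipPos_zero
  map_mul' β β' := unipPos_add β.toAdd β'.toAdd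

/-- Unfolding `unipPosHom`. [folklore] -/
@[simp]
theorem unipPosHom_apply (β : Multiplicative K) : unipPosHom K β = unipPos K β.toAdd := rfl

/-- The upper right entry of an element of `B(K)⁺`. [folklore] -/
def urEntry (γ : borelPos K) : K := ((borelPosToGL K γ : GL (Fin 2) K) : Matrix (Fin 2) (Fin 2) K) 0 1

/-- `urEntry (n β) = β`. [folklore] -/
@[simp]
theorem urEntry_unipPos (β : K) : urEntry (unipPos K β) = β := by
  rw [urEntry, borelPosToGL_unipPos, bMat_apply_zero_one]

variable {r : ℕ} (b : Fin r → K)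

/-- The unipotent lattice subgroup `N(Λ) = {n(β) : β ∈ Λ}`, `Λ = ⊕ ℤ bᵢ`, of `GL₂(K)`. [folklore] -/
abbrev latticeGL : Subgroup (GL (Fin 2) K) :=
  borelOf (Submodule.span ℤ (Set.range b)) ⊥ ⊥ (bot_preserves_left _) (bot_preserves_right _)

/-- The unipotent lattice subgroup `N(Λ)` of `B(K)⁺`. [folklore] -/
abbrev latticePos : Subgroup (borelPos K) := (latticeGL b).comap (borelPosToGL K)

/-- `n(β) ∈ N(Λ)` for `β ∈ Λ`. [folklore] -/
theorem unipPos_mem_latticePos {β : K} (hβ : β ∈ Submodule.span ℤ (Set.range b)) : unipPos K β ∈ latticePos b := by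
  rw [Subgroup.mem_comap, borelPosToGL_unipPos]
  exact bMat_mem_borelOf_iff.2 ⟨Subgroup.one_mem _, Subgroup.one_mem _, hβ⟩

/-- Every element of `N(Λ)` is an `n(β)`, `β ∈ Λ`. [folklore] -/
theorem exists_eq_unipPos_of_mem {γ : borelPos K} (hγ : γ ∈ latticePos b) :
    ∃ β ∈ Submodule.span ℤ (Set.range b), γ = unipPos K β := by
  obtain ⟨a, ha, d, hd, β, hβ, hγ'⟩ := (mem_borelOf_iff.1 (Subgroup.mem_comap.1 hγ))
  rw [Subgroup.mem_bot] at ha hd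
  subst ha hd
  exact ⟨β, hβ, borelPosToGL_injective (by rw [hγ', borelPosToGL_unipPos])⟩

/-- `β ↦ n(β)` as a homomorphism `Λ →* N(Λ)` (from `Multiplicative Λ`). [folklore] -/
def unipLatticeHom : Multiplicative (Submodule.span ℤ (Set.range b)) →* latticePos b where
  toFun β := ⟨unipPos K ((β.toAdd : Submodule.span ℤ (Set.range b)) : K), unipPos_mem_latticePos b β.toAdd.2⟩
  map_one' := Subtype.ext (by
    change unipPos K ((0 : Submodule.span ℤ (Set.range b)) : K) = 1
    rw [Submodule.coe_zero, unipPos_zero])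
  map_mul' β β' := Subtype.ext (by
    change unipPos K ((β.toAdd + β'.toAdd : Submodule.span ℤ (Set.range b)) : K) =
      unipPos K ((β.toAdd : Submodule.span ℤ (Set.range b)) : K) * unipPos K ((β'.toAdd : Submodule.span ℤ (Set.range b)) : K)
    rw [Submodule.coe_add, unipPos_add])

/-- Unfolding `unipLatticeHom`. [folklore] -/
theorem coe_unipLatticeHom (β : Multiplicative (Submodule.span ℤ (Set.range b))) :
    ((unipLatticeHom b β : latticePos b) : borelPos K) = unipPos K ((β.toAdd : Submodule.span ℤ (Set.range b)) : K) :=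
  rfl

/-- `unipLatticeHom` is injective. [folklore] -/
theorem unipLatticeHom_injective : Function.Injective (unipLatticeHom b) := fun β β' h => by
  have h' := congrArg (fun g : latticePos b => (g : borelPos K)) h
  simp only [coe_unipLatticeHom] at h'
  exact Multiplicative.toAdd.injective (Subtype.ext (unipPos_injective h'))

/-- `unipLatticeHom` is surjective. [folklore] -/
theorem unipLatticeHom_surjective : Function.Surjective (unipLatticeHom b) := fun g => by
  obtain ⟨β, hβ, hg⟩ := exists_eq_unipPos_of_mem b g.2
  exact ⟨Multiplicative.ofAdd ⟨β, hβ⟩, Subtype.ext (by rw [coe_unipLatticeHom, hg]; rfl)⟩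

/-- **`Λ ≅ N(Λ)`** (as `Multiplicative Λ ≃* N(Λ)`). [folklore] -/
def latticeEquiv : Multiplicative (Submodule.span ℤ (Set.range b)) ≃* latticePos b :=
  MulEquiv.ofBijective (unipLatticeHom b) ⟨unipLatticeHom_injective b, unipLatticeHom_surjective b⟩

/-- Unfolding `latticeEquiv`. [folklore] -/
theorem coe_latticeEquiv (β : Multiplicative (Submodule.span ℤ (Set.range b))) :
    ((latticeEquiv b β : latticePos b) : borelPos K) = unipPos K ((β.toAdd : Submodule.span ℤ (Set.range b)) : K) :=
  rfl

/-! ### `Λ ≅ ℤ^r`: generators, additive characters, multiplication by `x` -/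

/-- The generators `bₗ` of `Multiplicative Λ`. [folklore] -/
def latticeGen (l : Fin r) : Multiplicative (Submodule.span ℤ (Set.range b)) :=
  Multiplicative.ofAdd ⟨b l, Submodule.subset_span ⟨l, rfl⟩⟩

/-- `∏ₗ bₗ^{mₗ} = ∑ₗ mₗ bₗ`. [folklore] -/
theorem prod_latticeGen_zpow (m : Fin r → ℤ) :
    (((∏ l, latticeGen b l ^ m l).toAdd : Submodule.span ℤ (Set.range b)) : K) = ∑ l, m l • b l := by
  simp_rw [latticeGen, ← ofAdd_zsmul]
  rw [← ofAdd_sum, toAdd_ofAdd, Submodule.coe_sum]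
  refine Finset.sum_congr rfl fun l _ => ?_
  rw [Submodule.coe_smul]

/-- The `bₗ` generate. [folklore] -/
theorem latticeGen_generate (g : Multiplicative (Submodule.span ℤ (Set.range b))) :
    ∃ m : Fin r → ℤ, g = ∏ l, latticeGen b l ^ m l := by
  obtain ⟨m, hm⟩ := (Submodule.mem_span_range_iff_exists_fun ℤ).1 g.toAdd.2
  refine ⟨m, Multiplicative.toAdd.injective (Subtype.ext ?_)⟩
  rw [prod_latticeGen_zpow, hm]

/-- Uniqueness of the exponents (for `b` linearly independent). [folklore] -/
theorem latticeGen_independent (hli : LinearIndependent ℤ b) (m : Fin r → ℤ) (hm : ∏ l, latticeGen b l ^ m l = 1) :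
    m = 0 := by
  have h := congrArg (fun g : Multiplicative (Submodule.span ℤ (Set.range b)) =>
    ((g.toAdd : Submodule.span ℤ (Set.range b)) : K)) hm
  simp only [prod_latticeGen_zpow] at h
  have h0 : ∑ l, m l • b l = 0 := by rw [h]; rfl
  exact funext fun l => Fintype.linearIndependent_iff.1 hli m h0 l

variable {E : Type} [Field E]

/-- The additive character `τ|_Λ` of `Multiplicative Λ`. [folklore] -/
def latticeChar (τ : K →+* E) : Additive (Multiplicative (Submodule.span ℤ (Set.range b))) →+ E where
  toFun v := τ (((Additive.toMul v).toAdd : Submodule.span ℤ (Set.range b)) : K)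
  map_zero' := by
    change τ (((0 : Submodule.span ℤ (Set.range b))) : K) = 0
    rw [Submodule.coe_zero, map_zero]
  map_add' v w := by
    change τ (((Additive.toMul v).toAdd + (Additive.toMul w).toAdd : Submodule.span ℤ (Set.range b)) : K) = _
    rw [Submodule.coe_add, map_add]

/-- Unfolding `latticeChar`. [folklore] -/
@[simp]
theorem latticeChar_apply (τ : K →+* E) (v : Additive (Multiplicative (Submodule.span ℤ (Set.range b)))) :
    latticeChar b τ v = τ (((Additive.toMul v).toAdd : Submodule.span ℤ (Set.range b)) : K) := rfl

/-- **Multiplication by `x` on `Λ`** (for `Λ x ⊆ Λ`), as an endomorphism of `Multiplicative Λ`. [folklore] -/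
def latticeMul (x : K) (hx : ∀ β ∈ Submodule.span ℤ (Set.range b), β * x ∈ Submodule.span ℤ (Set.range b)) :
    Multiplicative (Submodule.span ℤ (Set.range b)) →* Multiplicative (Submodule.span ℤ (Set.range b)) where
  toFun v := Multiplicative.ofAdd ⟨((v.toAdd : Submodule.span ℤ (Set.range b)) : K) * x, hx _ v.toAdd.2⟩
  map_one' := Multiplicative.toAdd.injective (Subtype.ext (by
    change ((1 : Multiplicative (Submodule.span ℤ (Set.range b))).toAdd : K) * x = _
    rw [toAdd_one, Submodule.coe_zero, zero_mul]))
  map_mul' v w := Multiplicative.toAdd.injective (Subtype.ext (by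
    change ((v.toAdd + w.toAdd : Submodule.span ℤ (Set.range b)) : K) * x =
      ((v.toAdd : Submodule.span ℤ (Set.range b)) : K) * x + ((w.toAdd : Submodule.span ℤ (Set.range b)) : K) * x
    rw [Submodule.coe_add, add_mul]))

/-- Unfolding `latticeMul`. [folklore] -/
@[simp]
theorem coe_toAdd_latticeMul (x : K) (hx : ∀ β ∈ Submodule.span ℤ (Set.range b), β * x ∈ Submodule.span ℤ (Set.range b))
    (v : Multiplicative (Submodule.span ℤ (Set.range b))) :
    (((latticeMul b x hx v).toAdd : Submodule.span ℤ (Set.range b)) : K) = ((v.toAdd : Submodule.span ℤ (Set.range b)) : K) * x :=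
  rfl

/-- **Eigen-coordinates**: `τ|_Λ ∘ (·x) = τ(x) · τ|_Λ`. [cite: Harder1987, §2, (2.7)] -/
theorem precompHom_latticeMul_latticeChar (x : K)
    (hx : ∀ β ∈ Submodule.span ℤ (Set.range b), β * x ∈ Submodule.span ℤ (Set.range b)) (τ : K →+* E) :
    precompHom (latticeMul b x hx) (latticeChar b τ) = τ x • latticeChar b τ := by
  refine AddMonoidHom.ext fun v => ?_
  rw [AddMonoidHom.smul_apply, smul_eq_mul, show v = Additive.ofMul (Additive.toMul v) from rfl, precompHom_apply,
    latticeChar_apply, latticeChar_apply, toMul_ofMul, toMul_ofMul, coe_toAdd_latticeMul, map_mul, mul_comm]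

/-- Conjugation by `s` with `s ↦ diag(1, x)` is multiplication by `x` on `Λ` under `latticeEquiv`. [folklore] -/
theorem latticeEquiv_latticeMul {s : borelPos K} {x : Kˣ} (hs : borelPosToGL K s = bMat 1 0 x)
    (hx : ∀ β ∈ Submodule.span ℤ (Set.range b), β * x ∈ Submodule.span ℤ (Set.range b))
    (hsΛ : ∀ γ ∈ latticePos b, s⁻¹ * γ * s ∈ latticePos b) (v : Multiplicative (Submodule.span ℤ (Set.range b))) :
    latticeEquiv b (latticeMul b x hx v) = subgroupConj (latticePos b) s hsΛ (latticeEquiv b v) := by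
  refine Subtype.ext (borelPosToGL_injective ?_)
  rw [coe_latticeEquiv, coe_subgroupConj_apply, coe_latticeEquiv, map_mul, map_mul, map_inv, hs, borelPosToGL_unipPos,
    borelPosToGL_unipPos, diag_inv_mul_bMat_mul_diag, coe_toAdd_latticeMul]

/-! ### Independence of the characters `τ|_Λ` -/

variable [NumberField K]

/-- **The restrictions `τ|_Λ` of the embeddings to a lattice spanning `K` over `ℚ` are linearly
independent over `E`** (Dedekind's independence of characters). [folklore] -/
theorem linearIndependent_latticeChar [CharZero E] (hQ : ∀ y : K, ∃ q : Fin r → ℚ, y = ∑ l, (q l : K) * b l) :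
    LinearIndependent E (fun τ : K →+* E => latticeChar b τ) := by
  classical
  have hD : LinearIndependent E (fun τ : K →+* E => ((τ : K →* E) : K → E)) :=
    (linearIndependent_monoidHom K E).comp (fun τ : K →+* E => (τ : K →* E))
      (fun τ τ' h => RingHom.ext fun y => by simpa using DFunLike.congr_fun h y)
  rw [Fintype.linearIndependent_iff] at hD ⊢
  intro g hg
  have hl : ∀ l : Fin r, ∑ τ : K →+* E, g τ * τ (b l) = 0 := fun l => by
    have h1 := DFunLike.congr_fun hg (Additive.ofMul (Multiplicative.ofAdd ⟨b l, Submodule.subset_span ⟨l, rfl⟩⟩))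
    rw [AddMonoidHom.zero_apply, AddMonoidHom.finsetSum_apply] at h1
    simpa only [AddMonoidHom.smul_apply, latticeChar_apply, toMul_ofMul, toAdd_ofAdd, smul_eq_mul] using h1
  refine hD g (funext fun y => ?_)
  obtain ⟨q, hq⟩ := hQ y
  have h2 : ∑ τ : K →+* E, g τ * τ y = 0 := by
    calc ∑ τ : K →+* E, g τ * τ y = ∑ τ : K →+* E, ∑ l, (q l : E) * (g τ * τ (b l)) := by
          refine Finset.sum_congr rfl fun τ _ => ?_
          rw [hq, map_sum, Finset.mul_sum]
          refine Finset.sum_congr rfl fun l _ => ?_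
          rw [map_mul, map_ratCast]
          ring
      _ = ∑ l, (q l : E) * ∑ τ : K →+* E, g τ * τ (b l) := by
          rw [Finset.sum_comm]
          simp_rw [Finset.mul_sum]
      _ = 0 := by simp [hl]
  simpa [Finset.sum_apply] using h2

/-! ### The torus weights on `H•(Λ, E)` -/

/-- **The multiplications by `x` on `H•(Λ, E)`, scaled by an algebraic character `a`, are
scalar-filtered with algebraic characters** (`FreeAbelianCohomologyEigenbasis` with the characters
`τ|_Λ`, eigen-coordinates `τ(x)`). [cite: Harder1987, §2, (2.4)–(2.7)] -/
theorem scalarFiltered_latticeMul [CharZero E] (hli : LinearIndependent ℤ b)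
    (hQ : ∀ y : K, ∃ q : Fin r → ℚ, y = ∑ l, (q l : K) * b l)
    (hcard : Fintype.card (K →+* E) = r) {X : Type} (xu : X → K)
    (hxΛ : ∀ x, ∀ β ∈ Submodule.span ℤ (Set.range b), β * xu x ∈ Submodule.span ℤ (Set.range b))
    (hx0 : ∀ x, xu x ≠ 0) (a : X → E) (ha : a ∈ algCharSet (E := E) xu) (n : ℕ) :
    ScalarFiltered (fun x => pairMapₛ (k := E) (latticeMul b (xu x) (hxΛ x)) (a x) n) (algCharSet (E := E) xu) ⊤ := by
  classical
  let emb : (K →+* E) ≃ Fin r := Fintype.equivFinOfCardEq hcard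
  have hθ : LinearIndependent E (fun l : Fin r => latticeChar b (emb.symm l)) :=
    (linearIndependent_latticeChar b hQ).comp emb.symm emb.symm.injective
  have h := scalarFiltered_pairMapₛ_of_eigencoordinates (latticeGen b) (fun l => latticeChar b (emb.symm l))
    (latticeGen_generate b) (latticeGen_independent b hli) hθ (fun x => latticeMul b (xu x) (hxΛ x))
    (fun l x => emb.symm l (xu x)) a (fun l x => precompHom_latticeMul_latticeChar b (xu x) (hxΛ x) (emb.symm l)) n
  refine h.mono ?_
  rintro χ ⟨φ, rfl⟩
  exact mul_prod_embedding_mem_algCharSet xu ha hx0 fun i => emb.symm (φ i)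

/-! ### `E_η|_{N(Λ)}` is the trivial representation -/

section CharBridge

variable (η : borelPos K →* Eˣ)

/-- `E_η` restricted to `N(Λ)` and pulled back to `Multiplicative Λ`. [folklore] -/
abbrev latticeCharRep : Rep E (Multiplicative (Submodule.span ℤ (Set.range b))) :=
  Rep.res (latticeEquiv b : Multiplicative (Submodule.span ℤ (Set.range b)) →* latticePos b) (resSub (latticePos b) (charRep η))

omit [NumberField K] in
/-- The action of `E_η ∘ latticeEquiv`: multiplication by `η(n(β))`. [folklore] -/
theorem latticeCharRep_ρ_apply (g : Multiplicative (Submodule.span ℤ (Set.range b))) (r : E) :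
    (latticeCharRep b η).ρ g r = ((η (unipPos K ((g.toAdd : Submodule.span ℤ (Set.range b)) : K)) : Eˣ) : E) * r := rfl

variable (hηU : ∀ β : K, η (unipPos K β) = 1)

omit [NumberField K] in
include hηU in
/-- For `η` trivial on unipotents the action is trivial. [folklore] -/
theorem latticeCharRep_ρ_eq (g : Multiplicative (Submodule.span ℤ (Set.range b))) (r : E) :
    (latticeCharRep b η).ρ g r = r := by
  rw [latticeCharRep_ρ_apply, hηU, Units.val_one, one_mul]

/-- The identity `E_η ∘ latticeEquiv ⟶ E` (trivial representation). [folklore] -/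
def latticeCharToTriv : latticeCharRep b η ⟶ trivRep E (Multiplicative (Submodule.span ℤ (Set.range b))) :=
  Rep.ofHom (LinearMap.intertwiningMap_of_isIntertwiningMap _ _ LinearMap.id fun g r => by
    change (latticeCharRep b η).ρ g r = r
    exact latticeCharRep_ρ_eq b η hηU g r)

omit [NumberField K] in
/-- Unfolding `latticeCharToTriv`. [folklore] -/
@[simp]
theorem latticeCharToTriv_hom_apply (r : E) : (latticeCharToTriv b η hηU).hom r = r := rfl

/-- The identity `E ⟶ E_η ∘ latticeEquiv`. [folklore] -/
def latticeTrivToChar : trivRep E (Multiplicative (Submodule.span ℤ (Set.range b))) ⟶ latticeCharRep b η :=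
  Rep.ofHom (LinearMap.intertwiningMap_of_isIntertwiningMap _ _ LinearMap.id fun g r => by
    change r = (latticeCharRep b η).ρ g r
    exact (latticeCharRep_ρ_eq b η hηU g r).symm)

omit [NumberField K] in
/-- `E_η ∘ latticeEquiv ⟶ E ⟶ E_η ∘ latticeEquiv` is the identity. [folklore] -/
theorem latticeCharToTriv_comp : latticeCharToTriv b η hηU ≫ latticeTrivToChar b η hηU = 𝟙 _ :=
  Rep.hom_ext (Representation.IntertwiningMap.ext (LinearMap.ext fun _ => rfl))

/-- `Hⁿ` of the identity `E_η ∘ latticeEquiv ⟶ E`. [folklore] -/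
abbrev mapLatticeCharToTriv (n : ℕ) :
    groupCohomology (latticeCharRep b η) n ⟶ groupCohomology (trivRep E (Multiplicative (Submodule.span ℤ (Set.range b)))) n :=
  groupCohomology.map (MonoidHom.id _) (A := latticeCharRep b η)
    (B := trivRep E (Multiplicative (Submodule.span ℤ (Set.range b)))) (latticeCharToTriv b η hηU) n

omit [NumberField K] in
/-- `Hⁿ` of the identity `E_η ∘ latticeEquiv ⟶ E` is injective. [folklore] -/
theorem mapLatticeCharToTriv_injective (n : ℕ) : Function.Injective (mapLatticeCharToTriv b η hηU n).hom := by
  have hret : mapLatticeCharToTriv b η hηU n ≫ groupCohomology.map (MonoidHom.id _) (A := trivRep E _)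
      (B := latticeCharRep b η) (latticeTrivToChar b η hηU) n = 𝟙 _ := by
    rw [mapLatticeCharToTriv, ← groupCohomology.map_id_comp, latticeCharToTriv_comp, groupCohomology.map_id]
  intro u v huv
  have hu := congrArg (fun ψ => ψ.hom u) hret
  have hv := congrArg (fun ψ => ψ.hom v) hret
  simp only [ModuleCat.hom_comp, LinearMap.comp_apply, ModuleCat.hom_id, LinearMap.id_apply] at hu hv
  rw [← hu, ← hv, huv]

/-- The pair map `η(s)` on `E_η ∘ latticeEquiv` over the multiplication by `x`. [folklore] -/
def latticeCharPair (x : K) (hx : ∀ β ∈ Submodule.span ℤ (Set.range b), β * x ∈ Submodule.span ℤ (Set.range b)) (a : Eˣ) :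
    Rep.res (latticeMul b x hx) (latticeCharRep b η) ⟶ latticeCharRep b η :=
  Rep.ofHom (LinearMap.intertwiningMap_of_isIntertwiningMap _ _ ((a : E) • LinearMap.id) fun g r => by
    change (a : E) • ((latticeCharRep b η).ρ (latticeMul b x hx g) r) = (latticeCharRep b η).ρ g ((a : E) • r)
    rw [latticeCharRep_ρ_eq b η hηU, latticeCharRep_ρ_eq b η hηU])

omit [NumberField K] in
/-- Unfolding `latticeCharPair`. [folklore] -/
@[simp]
theorem latticeCharPair_hom_apply (x : K)
    (hx : ∀ β ∈ Submodule.span ℤ (Set.range b), β * x ∈ Submodule.span ℤ (Set.range b)) (a : Eˣ) (r : E) :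
    (latticeCharPair b η hηU x hx a).hom r = (a : E) * r := rfl

omit [NumberField K] in
/-- Composition of morphisms of representations on elements. [folklore] -/
theorem rep_comp_hom_apply {G' : Type} [Group G'] {A B C : Rep E G'} (f : A ⟶ B) (g : B ⟶ C) (x : A) :
    (f ≫ g).hom x = g.hom (f.hom x) := rfl

omit [NumberField K] in
/-- Restriction does not change underlying maps. [folklore] -/
theorem resFunctor_map_hom_apply {G' H' : Type} [Group G'] [Group H'] (f : G' →* H') {X Y : Rep E H'} (p : X ⟶ Y)
    (x : X) : ((Rep.resFunctor f).map p).hom x = p.hom x := rfl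

omit [NumberField K] in
/-- `Hⁿ` of the identity intertwines the pair map `η(s)` with the scaled pair map `Hⁿ(·x, η(s))` on
`Hⁿ(Λ, E)`. [folklore] -/
theorem mapLatticeCharToTriv_pair (x : K)
    (hx : ∀ β ∈ Submodule.span ℤ (Set.range b), β * x ∈ Submodule.span ℤ (Set.range b)) (a : Eˣ) (n : ℕ)
    (v : groupCohomology (latticeCharRep b η) n) :
    (mapLatticeCharToTriv b η hηU n).hom
        ((groupCohomology.map (latticeMul b x hx) (latticeCharPair b η hηU x hx a) n).hom v) =
      pairMapₛ (k := E) (latticeMul b x hx) (a : E) n ((mapLatticeCharToTriv b η hηU n).hom v) := by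
  have h : groupCohomology.map (latticeMul b x hx) (latticeCharPair b η hηU x hx a) n ≫ mapLatticeCharToTriv b η hηU n =
      mapLatticeCharToTriv b η hηU n ≫ groupCohomology.map (latticeMul b x hx) (pairScalar (latticeMul b x hx) (a : E)) n := by
    rw [mapLatticeCharToTriv, ← groupCohomology.map_comp, ← groupCohomology.map_comp]
    refine map_congr' rfl _ _ (fun r => ?_) n
    rw [rep_comp_hom_apply, rep_comp_hom_apply, resFunctor_map_hom_apply, resFunctor_map_hom_apply,
      latticeCharToTriv_hom_apply, latticeCharToTriv_hom_apply, latticeCharPair_hom_apply, pairScalar_hom_apply]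
  have := congrArg (fun ψ => ψ.hom v) h
  simpa only [ModuleCat.hom_comp, LinearMap.comp_apply] using this

end CharBridge

/-- **The torus operators on `H•(N(Λ), E_η)` are scalar-filtered with algebraic characters**, for a
character `η` of `B(K)⁺` trivial on the unipotent elements with `η(s_x)` algebraic, and integral torus
elements `s_x ↦ diag(1, x)` normalising `N(Λ)`. [cite: Harder1987, §2, (2.4)–(2.7)] -/
theorem scalarFiltered_conj_latticePos [CharZero E] (hli : LinearIndependent ℤ b)
    (hQ : ∀ y : K, ∃ q : Fin r → ℚ, y = ∑ l, (q l : K) * b l)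
    (hcard : Fintype.card (K →+* E) = r) {X : Type} (s : X → borelPos K) (xu : X → Kˣ)
    (hs : ∀ x, borelPosToGL K (s x) = bMat 1 0 (xu x))
    (hxΛ : ∀ x, ∀ β ∈ Submodule.span ℤ (Set.range b), β * xu x ∈ Submodule.span ℤ (Set.range b))
    (hsΛ : ∀ x, ∀ γ ∈ latticePos b, (s x)⁻¹ * γ * s x ∈ latticePos b)
    (η : borelPos K →* Eˣ) (hηU : ∀ β : K, η (unipPos K β) = 1)
    (ha : (fun x => ((η (s x) : Eˣ) : E)) ∈ algCharSet (E := E) (fun x => ((xu x : Kˣ) : K))) (n : ℕ) :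
    ScalarFiltered (fun x => (groupCohomology.map (subgroupConj (latticePos b) (s x) (hsΛ x))
      (resConj (latticePos b) (charRep η) (s x) (hsΛ x)) n).hom) (algCharSet (E := E) (fun x => ((xu x : Kˣ) : K))) ⊤ := by
  have hc : ∀ x g, latticeEquiv b (latticeMul b (xu x) (hxΛ x) g) = subgroupConj (latticePos b) (s x) (hsΛ x) (latticeEquiv b g) :=
    fun x g => latticeEquiv_latticeMul b (hs x) (hxΛ x) (hsΛ x) g
  have hB := scalarFiltered_latticeMul b hli hQ hcard (fun x => ((xu x : Kˣ) : K)) hxΛ (fun x => (xu x).ne_zero)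
    (fun x => ((η (s x) : Eˣ) : E)) ha n
  have h1 : ScalarFiltered (fun x => (groupCohomology.map (latticeMul b (xu x) (hxΛ x))
      (latticeCharPair b η hηU (xu x) (hxΛ x) (η (s x))) n).hom) (algCharSet (E := E) (fun x => ((xu x : Kˣ) : K))) ⊤ :=
    ScalarFiltered.of_injective (T' := fun x => pairMapₛ (k := E) (latticeMul b (xu x) (hxΛ x)) ((η (s x) : Eˣ) : E) n) _
      (mapLatticeCharToTriv_injective b η hηU n) (fun x v => mapLatticeCharToTriv_pair b η hηU (xu x) (hxΛ x) (η (s x)) n v) hB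
  exact (scalarFiltered_iff_of_mulEquiv (latticeEquiv b) (resSub (latticePos b) (charRep η))
    (fun x => subgroupConj (latticePos b) (s x) (hsΛ x)) (fun x => resConj (latticePos b) (charRep η) (s x) (hsΛ x))
    (fun x => latticeMul b (xu x) (hxΛ x)) hc (fun x => latticeCharPair b η hηU (xu x) (hxΛ x) (η (s x)))
    (fun x r => by rw [latticeCharPair_hom_apply, resConj_hom_apply]; rfl) _ n).2 h1

end Lattice

/-! ### The unit steps of `BorelLattice.chain`: explicit diagonal generators -/

section ChainUnits

variable {r s s' : ℕ} (b : Fin r → K) (u : Fin s → Kˣ) (u' : Fin s' → Kˣ)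
  (hAΛ : ∀ a ∈ unitSpan u s, ∀ x ∈ Submodule.span ℤ (Set.range b), (a : K) * x ∈ Submodule.span ℤ (Set.range b))
  (hDΛ : ∀ d ∈ unitSpan u' s', ∀ x ∈ Submodule.span ℤ (Set.range b), x * (d : K) ∈ Submodule.span ℤ (Set.range b))

/-- From `r` on the chain consists of `B(Λ, A', D')`'s with the full lattice `Λ`: conjugation by
`diag(1, x)` with `Λ x ⊆ Λ` preserves every term. [folklore] -/
theorem conj_diag_mem_chain (x : Kˣ) (hx : ∀ β ∈ latticeStep b r, β * x ∈ latticeStep b r) {j : ℕ} (hj : r ≤ j)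
    {g : GL (Fin 2) K} (hg : g ∈ chain b u u' hAΛ hDΛ j) :
    (bMat 1 0 x)⁻¹ * g * bMat 1 0 x ∈ chain b u u' hAΛ hDΛ j := by
  unfold chain at hg ⊢
  split_ifs at hg ⊢ with h1 h2
  · obtain rfl : j = r := le_antisymm h1 hj
    exact conj_diag_mem_borelOf x hx hg
  · exact conj_diag_mem_borelOf x hx hg
  · exact conj_diag_mem_borelOf x hx hg

/-- **`A`-steps: explicit generator `diag(u_i, 1)`.** [folklore] -/
theorem chain_cyclic_left_diag (hu : ∀ e : Fin s → ℤ, ∏ l, u l ^ e l = 1 → e = 0) (i : Fin s) {j : ℕ} (hj : j = r + i) :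
    bMat (u i) 0 1 ∈ chain b u u' hAΛ hDΛ (j + 1) ∧
      (∀ g ∈ chain b u u' hAΛ hDΛ (j + 1), ∃ h ∈ chain b u u' hAΛ hDΛ j, ∃ n : ℤ, g = h * bMat (u i) 0 1 ^ n) ∧
      (∀ n : ℤ, bMat (u i) 0 1 ^ n ∈ chain b u u' hAΛ hDΛ j → n = 0) := by
  subst hj
  have e0 : chain b u u' hAΛ hDΛ (r + i) = borelOf (latticeStep b r) (unitSpan u i) ⊥
      (unitSpan_preserves_left b u hAΛ i) (bot_preserves_right _) := by
    rcases Nat.eq_zero_or_pos i with h | h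
    · rw [h, Nat.add_zero]; exact chain_r_eq b u u' hAΛ hDΛ
    · rw [chain_of_r_lt b u u' hAΛ hDΛ (by omega) (by omega), Nat.add_sub_cancel_left]
  rw [e0, chain_of_r_lt b u u' hAΛ hDΛ (by omega) (by omega), show r + i + 1 - r = i + 1 by omega]
  refine ⟨bMat_mem_borelOf_iff.2 ⟨self_mem_unitSpan_succ u i, Subgroup.one_mem _, Submodule.zero_mem _⟩,
    fun g hg => ?_, fun n hn => ?_⟩
  · obtain ⟨a, ha, d, hd, x, hx, rfl⟩ := hg
    rw [Subgroup.mem_bot] at hd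
    subst hd
    obtain ⟨a₀, ha₀, n, rfl⟩ := exists_mem_unitSpan_mul_zpow u i ha
    refine ⟨bMat a₀ x 1, bMat_mem_borelOf_iff.2 ⟨ha₀, Subgroup.one_mem _, hx⟩, n, ?_⟩
    rw [bMat_diag_zpow, one_zpow, bMat_mul, mul_one]
    congr 1
    simp
  · rw [bMat_diag_zpow, one_zpow, bMat_mem_borelOf_iff] at hn
    exact eq_zero_of_zpow_mem_unitSpan hu i hn.1

/-- **`D`-steps: explicit generator `diag(1, u'_i)`.** [folklore] -/
theorem chain_cyclic_right_diag (hu' : ∀ e : Fin s' → ℤ, ∏ l, u' l ^ e l = 1 → e = 0) (i : Fin s') {j : ℕ}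
    (hj : j = r + s + i) :
    bMat 1 0 (u' i) ∈ chain b u u' hAΛ hDΛ (j + 1) ∧
      (∀ g ∈ chain b u u' hAΛ hDΛ (j + 1), ∃ h ∈ chain b u u' hAΛ hDΛ j, ∃ n : ℤ, g = h * bMat 1 0 (u' i) ^ n) ∧
      (∀ n : ℤ, bMat 1 0 (u' i) ^ n ∈ chain b u u' hAΛ hDΛ j → n = 0) := by
  subst hj
  have e0 : chain b u u' hAΛ hDΛ (r + s + i) = borelOf (latticeStep b r) (unitSpan u s) (unitSpan u' i)
      (unitSpan_preserves_left b u hAΛ s) (unitSpan_preserves_right b u' hDΛ i) := by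
    rcases Nat.eq_zero_or_pos i with h | h
    · rw [h, Nat.add_zero]; exact chain_rs_eq b u u' hAΛ hDΛ
    · rw [chain_of_rs_lt b u u' hAΛ hDΛ (by omega), show r + s + i - r - s = i by omega]
  rw [e0, chain_of_rs_lt b u u' hAΛ hDΛ (by omega), show r + s + i + 1 - r - s = i + 1 by omega]
  refine ⟨bMat_mem_borelOf_iff.2 ⟨Subgroup.one_mem _, self_mem_unitSpan_succ u' i, Submodule.zero_mem _⟩,
    fun g hg => ?_, fun n hn => ?_⟩
  · obtain ⟨a, ha, d, hd, x, hx, rfl⟩ := hg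
    obtain ⟨d₀, hd₀, n, rfl⟩ := exists_mem_unitSpan_mul_zpow u' i hd
    refine ⟨bMat a (x * (((u' i ^ n)⁻¹ : Kˣ) : K)) d₀, bMat_mem_borelOf_iff.2 ⟨ha, hd₀, ?_⟩, n, ?_⟩
    · exact unitSpan_preserves_right b u' hDΛ ((i : ℕ) + 1) _
        (Subgroup.inv_mem _ (Subgroup.zpow_mem _ (self_mem_unitSpan_succ u' i) n)) x hx
    · rw [bMat_diag_zpow, one_zpow, bMat_mul, mul_one]
      congr 1
      rw [mul_zero, zero_add, mul_assoc, ← Units.val_mul, inv_mul_cancel, Units.val_one, mul_one]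
  · rw [bMat_diag_zpow, one_zpow, bMat_mem_borelOf_iff] at hn
    exact eq_zero_of_zpow_mem_unitSpan hu' i hn.2.1

/-- The chain is monotone (iterated `chain_le_succ`). [folklore] -/
theorem chain_mono {i j : ℕ} (hij : i ≤ j) (hj : j ≤ r + s + s') : chain b u u' hAΛ hDΛ i ≤ chain b u u' hAΛ hDΛ j := by
  induction j with
  | zero =>
    rw [Nat.le_zero.1 hij]
  | succ j ih =>
    rcases hij.lt_or_eq with h | h
    · exact (ih (Nat.lt_succ_iff.1 h) (Nat.le_of_succ_le hj)).trans (chain_le_succ b u u' hAΛ hDΛ j hj)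
    · rw [h]

end ChainUnits

/-! ### Auxiliary facts on the box and the generators -/

section Aux

variable [NumberField K]

/-- The box is an `𝓞_K`-module: `β x ∈ Λ_t` for `β ∈ Λ_t` and `x` integral. [folklore] -/
theorem mul_mem_borelBox_of_valuation_le {𝔫 : Ideal (𝓞 K)} {t : Fin 2 → (FiniteAdeleRing (𝓞 K) K)ˣ} {β x : K}
    (hβ : β ∈ borelBox 𝔫 t) (hx : ∀ v : HeightOneSpectrum (𝓞 K), v.valuation K x ≤ 1) : β * x ∈ borelBox 𝔫 t := by
  intro v
  rw [map_mul]
  exact mul_le_of_le_of_le_one (hβ v) (hx v)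

/-- A `ℤ`-independent family of `[K:ℚ]` elements of `K` gives rational coordinates. [folklore] -/
theorem exists_rat_coords {b : Fin (Module.finrank ℚ K) → K} (hli : LinearIndependent ℤ b) (y : K) :
    ∃ q : Fin (Module.finrank ℚ K) → ℚ, y = ∑ l, (q l : K) * b l := by
  have hliQ : LinearIndependent ℚ b := (LinearIndependent.iff_fractionRing ℤ ℚ).1 hli
  haveI : Nonempty (Fin (Module.finrank ℚ K)) := ⟨⟨0, Module.finrank_pos⟩⟩
  let B := basisOfLinearIndependentOfCardEqFinrank hliQ (Fintype.card_fin _)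
  have hB : ⇑B = b := coe_basisOfLinearIndependentOfCardEqFinrank hliQ (Fintype.card_fin _)
  refine ⟨fun l => B.repr y l, ?_⟩
  conv_lhs => rw [← B.sum_repr y]
  refine Finset.sum_congr rfl fun l _ => ?_
  rw [hB, Rat.smul_def]

omit [NumberField K] in
/-- `B(Λ, A, D) ≤ B(K)⁺` (inside `GL₂(K)`) for totally positive `A, D`. [folklore] -/
theorem borelOf_le_range_borelPosToGL {Λ : Submodule ℤ K} {A D : Subgroup Kˣ} {hA : ∀ a ∈ A, ∀ y ∈ Λ, (a : K) * y ∈ Λ}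
    {hD : ∀ d ∈ D, ∀ y ∈ Λ, y * (d : K) ∈ Λ} (hApos : ∀ a ∈ A, ∀ τ : K →+* ℝ, 0 < τ (a : K))
    (hDpos : ∀ d ∈ D, ∀ τ : K →+* ℝ, 0 < τ (d : K)) : borelOf Λ A D hA hD ≤ (borelPosToGL K).range := by
  rintro _ ⟨a, ha, d, hd, β, -, rfl⟩
  have hpos : ∀ τ : K →+* ℝ, 0 < τ ((a : K) * d) := fun τ => by
    rw [map_mul]
    exact mul_pos (hApos a ha τ) (hDpos d hd τ)
  exact ⟨bMatPos a d β hpos, borelPosToGL_bMatPos a d β hpos⟩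

omit [NumberField K] in
/-- A character of `B(K)⁺` (values in a commutative group) is invariant under conjugation. [folklore] -/
theorem char_conj_eq {M : Type} [CommGroup M] (η : borelPos K →* M) (sx γ : borelPos K) : η (sx⁻¹ * γ * sx) = η γ := by
  rw [map_mul, map_mul, map_inv, mul_assoc, mul_comm (η γ) (η sx), ← mul_assoc, inv_mul_cancel, one_mul]

end Aux

/-! ### The torus weights on `H•(Γ_x, E_η)` -/

section Main

variable [NumberField K] {𝔫 : Ideal (𝓞 K)}

/-- **The torus operators on the cohomology `H•(Γ_x, E_η)` of the Borel stabilisers with character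
coefficients are scalar-filtered with algebraic characters.**  See the module docstring.
[cite: Harder1987, §2, (2.3)–(2.8)] -/
theorem scalarFiltered_pairMapChar_borelPosStabilizer (h𝔫 : 𝔫 ≠ 0) (t : Fin 2 → (FiniteAdeleRing (𝓞 K) K)ˣ)
    {c₀ : FiniteAdelicGL 2 K} (hc₀ : c₀ ∈ glFiniteIntegralLevel 2 K) {E : Type} [Field E] [CharZero E]
    (hcard : Fintype.card (K →+* E) = Module.finrank ℚ K) {X : Type} (s : X → borelPos K) (xu : X → Kˣ)
    (hxint : ∀ x (v : HeightOneSpectrum (𝓞 K)), v.valuation K ((xu x : Kˣ) : K) ≤ 1)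
    (hs : ∀ x, borelPosToGL K (s x) = bMat 1 0 (xu x))
    (hsΓ : ∀ x, ∀ γ ∈ borelPosStabilizer 𝔫 t c₀, (s x)⁻¹ * γ * s x ∈ borelPosStabilizer 𝔫 t c₀)
    (η : borelPos K →* Eˣ) (hηU : ∀ β : K, η (unipPos K β) = 1)
    (ha : (fun x => ((η (s x) : Eˣ) : E)) ∈ algCharSet (E := E) (fun x => ((xu x : Kˣ) : K)))
    (hηc : ∀ x (γ : borelPosStabilizer 𝔫 t c₀),
      (η.comp (borelPosStabilizer 𝔫 t c₀).subtype) (subgroupConj (borelPosStabilizer 𝔫 t c₀) (s x) (hsΓ x) γ) =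
        (η.comp (borelPosStabilizer 𝔫 t c₀).subtype) γ)
    (n : ℕ) :
    ScalarFiltered (fun x => pairMapChar (η.comp (borelPosStabilizer 𝔫 t c₀).subtype)
      (subgroupConj (borelPosStabilizer 𝔫 t c₀) (s x) (hsΓ x)) (hηc x) ((η (s x) : Eˣ) : E) n)
      (algCharSet (E := E) (fun x => ((xu x : Kˣ) : K))) ⊤ := by
  classical
  set Γst := borelPosStabilizer 𝔫 t c₀ with hΓst
  -- generators of the box
  obtain ⟨b, hb, hrepr⟩ := exists_generators_borelBox h𝔫 t
  have hspan : Submodule.span ℤ (Set.range b) = borelBox 𝔫 t :=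
    span_eq_of_generators hb fun β hβ => (hrepr β hβ).exists
  have hli : LinearIndependent ℤ b := by
    refine linearIndependent_of_unique_zero_repr fun m hm => ?_
    obtain ⟨m₀, -, huniq⟩ := hrepr 0 (zero_mem _)
    have h0 : (0 : K) = ∑ i, ((0 : Fin (Module.finrank ℚ K) → ℤ) i : K) * b i := by simp
    exact (huniq m hm).trans (huniq 0 h0).symm
  have hQ : ∀ y : K, ∃ q : Fin (Module.finrank ℚ K) → ℚ, y = ∑ l, (q l : K) * b l := exists_rat_coords hli
  -- the congruence units
  set u := congrUnitK K 𝔫 with hu_def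
  have hu : ∀ e : Fin (Units.rank K) → ℤ, ∏ l, u l ^ e l = 1 → e = 0 := eq_zero_of_prod_zpow_congrUnitK_eq_one h𝔫
  have hAc : unitSpan u (Units.rank K) ≤ congruentUnits K 𝔫 := by
    rintro _ ⟨e, -, rfl⟩
    exact Subgroup.prod_mem _ fun l _ => Subgroup.zpow_mem _ (congrUnitK_mem_congruentUnits h𝔫 l) _
  have hpos : ∀ (j : ℕ), ∀ a ∈ unitSpan u j, ∀ τ : K →+* ℝ, 0 < τ (a : K) := by
    rintro j _ ⟨e, -, rfl⟩ τ
    exact pos_prod_zpow_congrUnitK 𝔫 e τ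
  have hA : ∀ a ∈ unitSpan u (Units.rank K), ∀ x ∈ Submodule.span ℤ (Set.range b),
      (a : K) * x ∈ Submodule.span ℤ (Set.range b) := fun a ha' x hx => by
    rw [hspan] at hx ⊢
    exact globalUnits_mul_mem_borelBox 𝔫 t a (hAc ha').1 x hx
  have hD : ∀ d ∈ unitSpan u (Units.rank K), ∀ x ∈ Submodule.span ℤ (Set.range b),
      x * (d : K) ∈ Submodule.span ℤ (Set.range b) := fun d hd x hx => by
    rw [hspan] at hx ⊢
    exact mul_globalUnits_mem_borelBox 𝔫 t d (hAc hd).1 x hx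
  -- `x`-stability of the lattice
  have hxΛ : ∀ x, ∀ β ∈ Submodule.span ℤ (Set.range b), β * xu x ∈ Submodule.span ℤ (Set.range b) := by
    intro x β hβ
    rw [hspan] at hβ ⊢
    exact mul_mem_borelBox_of_valuation_le hβ (hxint x)
  have hxΛ' : ∀ x, ∀ β ∈ latticeStep b (Module.finrank ℚ K), β * xu x ∈ latticeStep b (Module.finrank ℚ K) := by
    intro x
    rw [latticeStep_of_le b le_rfl]
    exact hxΛ x
  -- the chain from the lattice on, pulled back to `B(K)⁺`
  let cGL : ℕ → Subgroup (GL (Fin 2) K) := fun i => chain b u u hA hD (Module.finrank ℚ K + i)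
  let cP : ℕ → Subgroup (borelPos K) := fun i => (cGL i).comap (borelPosToGL K)
  have hsc : ∀ x i, ∀ γ ∈ cP i, (s x)⁻¹ * γ * s x ∈ cP i := by
    intro x i γ hγ
    change borelPosToGL K ((s x)⁻¹ * γ * s x) ∈ chain b u u hA hD (Module.finrank ℚ K + i)
    rw [map_mul, map_mul, map_inv, hs]
    exact conj_diag_mem_chain b u u hA hD (xu x) (hxΛ' x) (Nat.le_add_right _ i) hγ
  have hlast : cGL (Units.rank K + Units.rank K) = borelOf (Submodule.span ℤ (Set.range b)) (unitSpan u (Units.rank K)) (unitSpan u (Units.rank K)) hA hD := by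
    change chain b u u hA hD (Module.finrank ℚ K + (Units.rank K + Units.rank K)) = _
    rw [← Nat.add_assoc, chain_last]
    ext g
    simp only [mem_borelOf_iff, latticeStep_of_le b le_rfl]
  have hrange : ∀ i ≤ Units.rank K + Units.rank K, cGL i ≤ (borelPosToGL K).range := fun i hi =>
    (chain_mono b u u hA hD (Nat.add_le_add_left hi _) (by omega)).trans
      (hlast.le.trans (borelOf_le_range_borelPosToGL (hpos _) (hpos _)))
  have hle : ∀ i < Units.rank K + Units.rank K, cP i ≤ cP (i + 1) := fun i hi =>
    Subgroup.comap_mono (chain_le_succ b u u hA hD (Module.finrank ℚ K + i) (by omega))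
  have hnorm : ∀ i < Units.rank K + Units.rank K, ((cP i).subgroupOf (cP (i + 1))).Normal := fun i hi => by
    haveI := chain_normal b u u hA hD (Module.finrank ℚ K + i) (by omega)
    exact normal_subgroupOf_comap (borelPosToGL K) (cGL i) (cGL (i + 1))
  have hcyc : ∀ i < Units.rank K + Units.rank K, ∃ t' ∈ cP (i + 1), (∀ x, (s x)⁻¹ * t' * s x = t') ∧
      (∀ g ∈ cP (i + 1), ∃ h ∈ cP i, ∃ n : ℤ, g = h * t' ^ n) ∧ (∀ n : ℤ, t' ^ n ∈ cP i → n = 0) := by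
    intro i hi
    obtain ⟨a, d, htmem, hgen, hfree⟩ : ∃ a d : Kˣ, bMat a 0 d ∈ cGL (i + 1) ∧
        (∀ g ∈ cGL (i + 1), ∃ h ∈ cGL i, ∃ n : ℤ, g = h * bMat a 0 d ^ n) ∧
        (∀ n : ℤ, bMat a 0 d ^ n ∈ cGL i → n = 0) := by
      rcases Nat.lt_or_ge i (Units.rank K) with h1 | h1
      · obtain ⟨h₁, h₂, h₃⟩ := chain_cyclic_left_diag b u u hA hD hu ⟨i, h1⟩ (j := Module.finrank ℚ K + i) rfl
        exact ⟨u ⟨i, h1⟩, 1, h₁, h₂, h₃⟩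
      · obtain ⟨j, rfl⟩ : ∃ j, i = Units.rank K + j := ⟨i - Units.rank K, by omega⟩
        obtain ⟨h₁, h₂, h₃⟩ := chain_cyclic_right_diag b u u hA hD hu ⟨j, by omega⟩ (j := Module.finrank ℚ K + (Units.rank K + j))
          (show Module.finrank ℚ K + (Units.rank K + j) = Module.finrank ℚ K + Units.rank K + j by omega)
        exact ⟨1, u ⟨j, by omega⟩, h₁, h₂, h₃⟩
    obtain ⟨t', ht', ht'eq, hgen', hfree'⟩ := cyclic_comap (borelPosToGL K) (hrange (i + 1) hi) htmem hgen hfree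
    refine ⟨t', ht', fun x => borelPosToGL_injective ?_, hgen', hfree'⟩
    rw [map_mul, map_mul, map_inv, hs, ht'eq, diag_inv_mul_bMat_mul_diag, zero_mul]
  -- the base: the lattice subgroup `cP 0 = N(Λ)`
  have hsΛ : ∀ x, ∀ γ ∈ latticePos b, (s x)⁻¹ * γ * s x ∈ latticePos b := by
    intro x γ hγ
    rw [Subgroup.mem_comap] at hγ ⊢
    rw [map_mul, map_mul, map_inv, hs]
    exact conj_diag_mem_borelOf (xu x) (hxΛ x) hγ
  have heq : cP 0 = latticePos b := by
    ext g
    change borelPosToGL K g ∈ chain b u u hA hD (Module.finrank ℚ K + 0) ↔ borelPosToGL K g ∈ latticeGL b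
    rw [Nat.add_zero, chain_of_le_r b u u hA hD le_rfl, mem_borelOf_iff, mem_borelOf_iff, latticeStep_of_le b le_rfl]
  have h0 : ∀ n, ScalarFiltered (conjPairEnd (charRep η) s cP hsc 0 n) (algCharSet (E := E) (fun x => ((xu x : Kˣ) : K))) ⊤ := by
    intro n
    have hbase := scalarFiltered_conj_latticePos b hli hQ hcard s xu hs hxΛ hsΛ η hηU ha n
    let e : ↥(cP 0) ≃* ↥(latticePos b) := MulEquiv.subgroupCongr heq
    exact (scalarFiltered_iff_of_mulEquiv e (resSub (latticePos b) (charRep η))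
      (fun x => subgroupConj (latticePos b) (s x) (hsΛ x)) (fun x => resConj (latticePos b) (charRep η) (s x) (hsΛ x))
      (fun x => subgroupConj (cP 0) (s x) (hsc x 0)) (fun x g => Subtype.ext rfl)
      (fun x => resConj (cP 0) (charRep η) (s x) (hsc x 0)) (fun x a => rfl) _ n).1 hbase
  -- the unit steps
  have hG3 := scalarFiltered_conj_of_chain (charRep η) s cP hsc (algCharSet (E := E) (fun x => ((xu x : Kˣ) : K))) h0
    (Units.rank K + Units.rank K) hle hnorm hcyc n
  -- the finite-index ascent to `Γ_x`
  have h01 : borelOf (Submodule.span ℤ (Set.range b)) (unitSpan u (Units.rank K)) (unitSpan u (Units.rank K)) hA hD ≤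
      Γst.map (borelPosToGL K) := borelOf_le_map_borelPosStabilizer t hc₀ hAc (hpos _) hspan.le
  have h12 : Γst.map (borelPosToGL K) ≤ borelBoxUnits 𝔫 t := map_borelPosStabilizer_le_borelBoxUnits t hc₀
  have hcPm_le : cP (Units.rank K + Units.rank K) ≤ Γst := by
    have h := Subgroup.comap_mono (f := borelPosToGL K) (hlast.le.trans h01)
    rwa [Subgroup.comap_map_eq_self_of_injective borelPosToGL_injective] at h
  haveI hfin := finite_borelBoxUnits_quotient h𝔫 t hspan (hA := hA) (hD := hD)
  have hfi2 : ((borelOf (Submodule.span ℤ (Set.range b)) (unitSpan u (Units.rank K)) (unitSpan u (Units.rank K)) hA hD).subgroupOf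
      (borelBoxUnits 𝔫 t)).FiniteIndex := Subgroup.finiteIndex_of_finite_quotient
  have hfi3 : ((borelOf (Submodule.span ℤ (Set.range b)) (unitSpan u (Units.rank K)) (unitSpan u (Units.rank K)) hA hD).subgroupOf
      (Γst.map (borelPosToGL K))).FiniteIndex :=
    ⟨fun h0' => hfi2.index_ne_zero (Subgroup.relIndex_eq_zero_of_le_right h12 h0')⟩
  haveI : ((cP (Units.rank K + Units.rank K)).subgroupOf Γst).FiniteIndex := by
    refine ⟨fun h0' => hfi3.index_ne_zero ?_⟩
    change (borelOf _ _ _ hA hD).relIndex (Γst.map (borelPosToGL K)) = 0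
    rw [← hlast, ← Subgroup.relIndex_comap]
    exact h0'
  have hN : ((((cP (Units.rank K + Units.rank K)).subgroupOf Γst).index : ℕ) : E) ≠ 0 := Nat.cast_ne_zero.2 Subgroup.FiniteIndex.index_ne_zero
  let cΓ := fun x => subgroupConj Γst (s x) (hsΓ x)
  let V := charRep (η.comp Γst.subtype)
  let φΓ := fun x => pairScalarChar (η.comp Γst.subtype) (cΓ x) (hηc x) ((η (s x) : Eˣ) : E)
  have hcΓ₀ : ∀ x, ∀ h ∈ (cP (Units.rank K + Units.rank K)).subgroupOf Γst, cΓ x h ∈ (cP (Units.rank K + Units.rank K)).subgroupOf Γst := fun x h hh =>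
    Subgroup.mem_subgroupOf.2 (hsc x (Units.rank K + Units.rank K) _ (Subgroup.mem_subgroupOf.1 hh))
  have h0' : ScalarFiltered (fun x => (groupCohomology.map (restrictEnd ((cP (Units.rank K + Units.rank K)).subgroupOf Γst) (cΓ x) (hcΓ₀ x))
      (resPair ((cP (Units.rank K + Units.rank K)).subgroupOf Γst) V (cΓ x) (hcΓ₀ x) (φΓ x)) n).hom)
      (algCharSet (E := E) (fun x => ((xu x : Kˣ) : K))) ⊤ := by
    let e : ↥((cP (Units.rank K + Units.rank K)).subgroupOf Γst) ≃* ↥(cP (Units.rank K + Units.rank K)) := Subgroup.subgroupOfEquivOfLe hcPm_le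
    exact (scalarFiltered_iff_of_mulEquiv e (resSub (cP (Units.rank K + Units.rank K)) (charRep η))
      (fun x => subgroupConj (cP (Units.rank K + Units.rank K)) (s x) (hsc x (Units.rank K + Units.rank K))) (fun x => resConj (cP (Units.rank K + Units.rank K)) (charRep η) (s x) (hsc x (Units.rank K + Units.rank K)))
      (fun x => restrictEnd ((cP (Units.rank K + Units.rank K)).subgroupOf Γst) (cΓ x) (hcΓ₀ x)) (fun x g => Subtype.ext rfl)
      (fun x => resPair ((cP (Units.rank K + Units.rank K)).subgroupOf Γst) V (cΓ x) (hcΓ₀ x) (φΓ x)) (fun x a => rfl) _ n).1 hG3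
  exact scalarFiltered_of_finiteIndex ((cP (Units.rank K + Units.rank K)).subgroupOf Γst) V hN cΓ hcΓ₀ φΓ _ n h0'

end Main

end ResGLnCohomology

end Literature.NumberTheory.Automorphic

end
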